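import Literature.NumberTheory.EllipticCurves.FormalGroupLogHomAbelProofs
import Literature.NumberTheory.EllipticCurves.FormalGroupNegOmegaProofs
import Literature.NumberTheory.EllipticCurves.FormalGroupDictionaryProofs
import Mathlib.Algebra.MvPolynomial.CommRing
import HarnessLib

/-!
# The formal-group axioms of the chord–tangent law over EVERY commutative ring
# (Silverman AEC IV.2.1–2.2, IV.5.5; proofs only)

Trunk T-NT-EC (Literature/NumberTheory/EllipticCurves). The chord–tangent formal group law
`F = formalGroupLaw W ∈ R⟦z₁, z₂⟧` of a Weierstrass curve (`FormalGroupLaw.lean`, AEC IV.1) is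
defined over any commutative ring, but so far the tree has its AXIOMS — associativity,
commutativity, `F(z, 0) = z`, `F(z, i(z)) = 0` — only for `p`-integral equations over `ℚ_p`
(`FormalGroupLawAxiomsProofs`, `FormalGroupLawAssocIntegralProofs`: from the group law on
`E₁(ℚ_p)` by the identity theorem). Here they are proved for EVERY Weierstrass curve over EVERY
commutative ring, as Silverman states them (AEC IV.2.2 ("more generally … an elliptic curve given
by a Weierstrass equation with coefficients in any ring `R` … a formal group law"), with the remark
of IV.2 that non-singularity is never used):

* over a `ℚ`-algebra that is a domain, `formalGroupLaw_eq_formalExp_subst` /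
  `formalGroupLaw_eq_formalGroupLawQ` — **`F(z₁, z₂) = exp_W(log_W z₁ + log_W z₂)`**
  (AEC IV.5.5: `log` is an isomorphism `Ê ≅ 𝔾̂ₐ`), from the tree's unconditional
  `formalLog_subst_formalGroupLaw` (`log F = log z₁ + log z₂`, proved by the invariance of `ω`)
  and `exp ∘ log = z`; and `formalLog_subst_formalNeg` — **`log_W(i(z)) = -log_W(z)`** (from
  `[-1]^*ω = -ω`, `formalEta_mul_derivative_formalNeg`); whence the four axioms over such rings;
* `WeierstrassCurve.universalInt` — the universal equation over `ℤ[a₁, a₂, a₃, a₄, a₆]`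
  (`MvPolynomial (Fin 5) ℤ`) with `universalInt_map : universalInt.map (ev_W) = W`; the axioms
  hold for it because `ℤ[aᵢ] ↪ ℚ[aᵢ]` (a `ℚ`-algebra domain) and all the series commute with
  base change (`map_formalGroupLaw`, `map_formalNeg`);
* for every `W` over every commutative ring `R` (specialise the universal identities):
  **`formalGroupLaw_assoc'`** — `F(F(z₁,z₂),z₃) = F(z₁,F(z₂,z₃))`;
  **`formalGroupLaw_comm'`** — `F(z₂,z₁) = F(z₁,z₂)`; **`formalGroupLaw_subst_X_zero'`** —
  `F(z, 0) = z`; **`formalGroupLaw_subst_X_formalNeg'`** — `F(z, i(z)) = 0`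
  (the primed names are the ring-general versions of the `ℚ_p` statements of
  `FormalGroupLawAxiomsProofs.lean`, with literally the same left and right sides).

## Sources

* J. H. Silverman, *The Arithmetic of Elliptic Curves*, 2nd ed. (2009): IV.1 (the law `F`,
  `i`), IV.2.1–2.2 (formal group axioms; "`F` is a formal group law over `ℤ[a₁,…,a₆]`"), IV.4.2,
  IV.5.5 (`log_𝓕 : 𝓕 → 𝔾̂ₐ` an isomorphism over `R ⊗ ℚ`). [SilvermanAEC2009]

## Design notes

Pure proof file plus one definition with body (`universalInt`). The transfer
`ℚ[aᵢ]-identity ⇒ ℤ[aᵢ]-identity ⇒ R-identity` only uses `MvPowerSeries.map_subst`,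
`map_formalGroupLaw`, `map_formalNeg` and the injectivity of `MvPowerSeries.map` along
`ℤ[aᵢ] ↪ ℚ[aᵢ]`.
-/

noncomputable section

open PowerSeries Literature.NumberTheory.EllipticCurves

namespace WeierstrassCurve

/-! ### Generic substitution facts -/

section Subst

variable {R : Type*} [CommRing R]

/-- The pair `(zᵢ, zⱼ)` of variables is substitutable. [folklore] -/
theorem hasSubst_X_pair {σ : Type*} (i j : σ) :
    MvPowerSeries.HasSubst ![(MvPowerSeries.X i : MvPowerSeries σ R), MvPowerSeries.X j] :=
  MvPowerSeries.hasSubst_of_constantCoeff_zero fun k => by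
    fin_cases k <;> exact MvPowerSeries.constantCoeff_X _

/-- A pair of series without constant terms is substitutable. [folklore] -/
theorem hasSubst_pair {σ : Type*} {g h : MvPowerSeries σ R} (hg : MvPowerSeries.constantCoeff g = 0)
    (hh : MvPowerSeries.constantCoeff h = 0) : MvPowerSeries.HasSubst ![g, h] :=
  MvPowerSeries.hasSubst_of_constantCoeff_zero fun k => by
    fin_cases k
    · exact hg
    · exact hh

/-- `MvPowerSeries.map` along an injective ring map is injective. [folklore] -/
theorem mvPowerSeries_map_injective {σ : Type*} {S : Type*} [CommRing S] {φ : R →+* S}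
    (hφ : Function.Injective φ) : Function.Injective (MvPowerSeries.map (σ := σ) φ) := by
  intro f g h
  ext d
  apply hφ
  rw [← MvPowerSeries.coeff_map, ← MvPowerSeries.coeff_map, h]

end Subst

/-! ### Over a `ℚ`-algebra domain: `F = exp(log z₁ + log z₂)`, `log ∘ i = -log`, and the axioms -/

section RatDomain

variable {A : Type*} [CommRing A] [Algebra ℚ A] (V : WeierstrassCurve A)

/-- `log_W` is substitutable. [folklore] -/
theorem hasSubst_formalLog : PowerSeries.HasSubst V.formalLog :=
  PowerSeries.HasSubst.of_constantCoeff_zero' V.constantCoeff_formalLog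

/-- `log_W z₁ + log_W z₂` has no constant term. [folklore] -/
theorem constantCoeff_formalLog_add :
    MvPowerSeries.constantCoeff (V.formalLog.subst (MvPowerSeries.X 0 : MvPowerSeries (Fin 2) A) +
      V.formalLog.subst (MvPowerSeries.X 1 : MvPowerSeries (Fin 2) A)) = 0 := by
  rw [map_add, PowerSeries.constantCoeff_subst_eq_zero (MvPowerSeries.constantCoeff_X _) _
    V.constantCoeff_formalLog, PowerSeries.constantCoeff_subst_eq_zero
    (MvPowerSeries.constantCoeff_X _) _ V.constantCoeff_formalLog, add_zero]

/-- `log_W z₁ + log_W z₂` is substitutable. [folklore] -/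
theorem hasSubst_formalLog_add :
    PowerSeries.HasSubst (V.formalLog.subst (MvPowerSeries.X 0 : MvPowerSeries (Fin 2) A) +
      V.formalLog.subst (MvPowerSeries.X 1 : MvPowerSeries (Fin 2) A)) :=
  PowerSeries.HasSubst.of_constantCoeff_zero V.constantCoeff_formalLog_add

/-- `log_W ∘ z = log_W`. [folklore] -/
theorem formalLog_subst_X : V.formalLog.subst (PowerSeries.X : A⟦X⟧) = V.formalLog := by
  rw [← PowerSeries.map_algebraMap_eq_subst_X, Algebra.algebraMap_self, PowerSeries.map_id, id]

variable [IsDomain A]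

/-- **`F(z₁, z₂) = exp_W(log_W z₁ + log_W z₂)`** over a `ℚ`-algebra domain: apply `exp_W` to the
tree's `log_W F = log_W z₁ + log_W z₂` (`formalLog_subst_formalGroupLaw`) and use
`exp_W ∘ log_W = z`. [Silverman AEC IV.5.5 (`log_𝓕` is an isomorphism `𝓕 ≅ 𝔾̂ₐ` over `R ⊗ ℚ`)]
[cite: SilvermanAEC2009, IV.5.5] -/
theorem formalGroupLaw_eq_formalExp_subst :
    V.formalGroupLaw = V.formalExp.subst
      (V.formalLog.subst (MvPowerSeries.X 0 : MvPowerSeries (Fin 2) A) +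
        V.formalLog.subst (MvPowerSeries.X 1 : MvPowerSeries (Fin 2) A)) := by
  have hF := V.hasSubst_formalGroupLaw
  rw [← V.formalLog_subst_formalGroupLaw]
  have h := PowerSeries.subst_comp_subst_apply (hasSubst_formalLog V) hF V.formalExp
  rw [formalExp_subst_formalLog, PowerSeries.subst_X hF] at h
  exact h

/-- The chord–tangent law IS the tree's `formalGroupLawQ = exp_W(log_W z₁ + log_W z₂)` over a
`ℚ`-algebra domain. [Silverman AEC IV.5.5] [cite: SilvermanAEC2009, IV.5.5] -/
theorem formalGroupLaw_eq_formalGroupLawQ : V.formalGroupLaw = V.formalGroupLawQ :=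
  V.formalGroupLaw_eq_formalExp_subst

omit [IsDomain A] in
/-- **`log_W(i(z)) = -log_W(z)`**: both sides vanish at `0` and have derivative `-ω`
(`[-1]^*ω = -ω`, the tree's `formalEta_mul_derivative_formalNeg`). [Silverman AEC IV.5, III.5]
[folklore] -/
theorem formalLog_subst_formalNeg : V.formalLog.subst V.formalNeg = -V.formalLog := by
  haveI : IsAddTorsionFree A := IsAddTorsionFree.of_module_rat (M := A)
  have hi : PowerSeries.HasSubst V.formalNeg :=
    PowerSeries.HasSubst.of_constantCoeff_zero' V.constantCoeff_formalNeg
  refine derivative.ext ?_ ?_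
  · rw [derivative_subst A hi, derivative_formalLog, map_neg, derivative_formalLog]
    -- `ω(i) · i' = -ω`: multiply by the unit `η` (`ηω = 1`, `η i' = -η(i)`)
    have hη : IsUnit V.formalEta :=
      PowerSeries.isUnit_iff_constantCoeff.mpr (by rw [constantCoeff_formalEta]; exact isUnit_one)
    refine hη.mul_left_cancel ?_
    have h1 : V.formalEta.subst V.formalNeg * V.formalOmega.subst V.formalNeg = 1 := by
      rw [← PowerSeries.subst_mul hi, formalEta_mul_formalOmega, ← PowerSeries.coe_substAlgHom hi,
        map_one]
    calc V.formalEta * (V.formalOmega.subst V.formalNeg * d⁄dX A V.formalNeg)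
        = V.formalOmega.subst V.formalNeg * (V.formalEta * d⁄dX A V.formalNeg) := by ring
      _ = -(V.formalEta.subst V.formalNeg * V.formalOmega.subst V.formalNeg) := by
        rw [formalEta_mul_derivative_formalNeg]; ring
      _ = V.formalEta * -V.formalOmega := by rw [h1, mul_neg, formalEta_mul_formalOmega]
  · have h0 := PowerSeries.constantCoeff_subst_eq_zero V.constantCoeff_formalNeg _
      V.constantCoeff_formalLog
    rw [map_neg, constantCoeff_formalLog, neg_zero]
    exact h0

/-- **Commutativity over a `ℚ`-algebra domain**: `F(z₂, z₁) = F(z₁, z₂)`.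
[Silverman AEC IV.2.1 (c)] [folklore] -/
theorem formalGroupLaw_comm_rat :
    MvPowerSeries.subst ![(MvPowerSeries.X 1 : MvPowerSeries (Fin 2) A), MvPowerSeries.X 0]
        V.formalGroupLaw = V.formalGroupLaw := by
  have hs := hasSubst_X_pair (R := A) (σ := Fin 2) 1 0
  rw [V.formalGroupLaw_eq_formalExp_subst, mvSubst_powerSeries_subst V.hasSubst_formalLog_add hs,
    MvPowerSeries.subst_add hs, mvSubst_powerSeries_subst (PowerSeries.HasSubst.X 0) hs,
    mvSubst_powerSeries_subst (PowerSeries.HasSubst.X 1) hs, MvPowerSeries.subst_X hs,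
    MvPowerSeries.subst_X hs]
  simp only [Matrix.cons_val_zero, Matrix.cons_val_one]
  rw [add_comm]

/-- `log_W(F(zᵢ, zⱼ)) = log_W zᵢ + log_W zⱼ` for any two of three variables. [Silverman AEC IV.5.2]
[folklore] -/
theorem formalLog_subst_formalGroupLaw_X_pair (i j : Fin 3) :
    V.formalLog.subst (MvPowerSeries.subst
        ![(MvPowerSeries.X i : MvPowerSeries (Fin 3) A), MvPowerSeries.X j] V.formalGroupLaw) =
      V.formalLog.subst (MvPowerSeries.X i : MvPowerSeries (Fin 3) A) +
        V.formalLog.subst (MvPowerSeries.X j : MvPowerSeries (Fin 3) A) := by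
  have hs := hasSubst_X_pair (R := A) (σ := Fin 3) i j
  rw [← mvSubst_powerSeries_subst V.hasSubst_formalGroupLaw hs, V.formalLog_subst_formalGroupLaw,
    MvPowerSeries.subst_add hs, mvSubst_powerSeries_subst (PowerSeries.HasSubst.X 0) hs,
    mvSubst_powerSeries_subst (PowerSeries.HasSubst.X 1) hs, MvPowerSeries.subst_X hs,
    MvPowerSeries.subst_X hs]
  simp only [Matrix.cons_val_zero, Matrix.cons_val_one]

/-- `F(g, h) = exp_W(log_W g + log_W h)` for series `g, h` without constant term.
[Silverman AEC IV.5.5] [folklore] -/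
theorem subst_pair_formalGroupLaw_eq {σ : Type*} {g h : MvPowerSeries σ A}
    (hg : MvPowerSeries.constantCoeff g = 0) (hh : MvPowerSeries.constantCoeff h = 0) :
    MvPowerSeries.subst ![g, h] V.formalGroupLaw =
      V.formalExp.subst (V.formalLog.subst g + V.formalLog.subst h) := by
  have hs := hasSubst_pair hg hh
  rw [V.formalGroupLaw_eq_formalExp_subst, mvSubst_powerSeries_subst V.hasSubst_formalLog_add hs,
    MvPowerSeries.subst_add hs, mvSubst_powerSeries_subst (PowerSeries.HasSubst.X 0) hs,
    mvSubst_powerSeries_subst (PowerSeries.HasSubst.X 1) hs, MvPowerSeries.subst_X hs,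
    MvPowerSeries.subst_X hs]
  simp only [Matrix.cons_val_zero, Matrix.cons_val_one]

/-- **Associativity over a `ℚ`-algebra domain**: `F(F(z₁,z₂),z₃) = F(z₁,F(z₂,z₃))`, both being
`exp_W(log_W z₁ + log_W z₂ + log_W z₃)`. [Silverman AEC IV.2.1 (b)] [folklore] -/
theorem formalGroupLaw_assoc_rat :
    MvPowerSeries.subst ![MvPowerSeries.subst ![(MvPowerSeries.X 0 : MvPowerSeries (Fin 3) A),
        MvPowerSeries.X 1] V.formalGroupLaw, MvPowerSeries.X 2] V.formalGroupLaw =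
      MvPowerSeries.subst ![(MvPowerSeries.X 0 : MvPowerSeries (Fin 3) A),
        MvPowerSeries.subst ![(MvPowerSeries.X 1 : MvPowerSeries (Fin 3) A), MvPowerSeries.X 2]
          V.formalGroupLaw] V.formalGroupLaw := by
  have h01 : MvPowerSeries.constantCoeff (MvPowerSeries.subst
      ![(MvPowerSeries.X 0 : MvPowerSeries (Fin 3) A), MvPowerSeries.X 1] V.formalGroupLaw) = 0 :=
    MvPowerSeries.constantCoeff_subst_eq_zero (hasSubst_X_pair 0 1)
      (fun k => by fin_cases k <;> exact MvPowerSeries.constantCoeff_X _) V.constantCoeff_formalGroupLaw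
  have h12 : MvPowerSeries.constantCoeff (MvPowerSeries.subst
      ![(MvPowerSeries.X 1 : MvPowerSeries (Fin 3) A), MvPowerSeries.X 2] V.formalGroupLaw) = 0 :=
    MvPowerSeries.constantCoeff_subst_eq_zero (hasSubst_X_pair 1 2)
      (fun k => by fin_cases k <;> exact MvPowerSeries.constantCoeff_X _) V.constantCoeff_formalGroupLaw
  rw [V.subst_pair_formalGroupLaw_eq h01 (MvPowerSeries.constantCoeff_X 2),
    V.subst_pair_formalGroupLaw_eq (MvPowerSeries.constantCoeff_X 0) h12,
    formalLog_subst_formalGroupLaw_X_pair, formalLog_subst_formalGroupLaw_X_pair, add_assoc]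

/-- **Neutral element over a `ℚ`-algebra domain**: `F(z, 0) = z` (`= exp_W(log_W z + 0)`).
[Silverman AEC IV.2.1 (e)] [folklore] -/
theorem formalGroupLaw_subst_X_zero_rat :
    MvPowerSeries.subst ![(PowerSeries.X : A⟦X⟧), 0] V.formalGroupLaw = PowerSeries.X := by
  rw [V.subst_pair_formalGroupLaw_eq PowerSeries.constantCoeff_X (map_zero _),
    formalLog_subst_X, PowerSeries.subst_zero_of_constantCoeff_zero V.constantCoeff_formalLog,
    add_zero, formalExp_subst_formalLog]

/-- **Inverse over a `ℚ`-algebra domain**: `F(z, i(z)) = 0` (`= exp_W(log_W z - log_W z)`).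
[Silverman AEC IV.2.1 (d)] [folklore] -/
theorem formalGroupLaw_subst_X_formalNeg_rat :
    MvPowerSeries.subst ![(PowerSeries.X : A⟦X⟧), V.formalNeg] V.formalGroupLaw = 0 := by
  rw [V.subst_pair_formalGroupLaw_eq PowerSeries.constantCoeff_X V.constantCoeff_formalNeg,
    formalLog_subst_X, formalLog_subst_formalNeg, add_neg_cancel,
    PowerSeries.subst_zero_of_constantCoeff_zero V.constantCoeff_formalExp]

end RatDomain

/-! ### The universal Weierstrass equation over `ℤ[a₁, a₂, a₃, a₄, a₆]` -/

section Universal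

/-- **The universal Weierstrass equation** `y² + a₁xy + a₃y = x³ + a₂x² + a₄x + a₆` over
`ℤ[a₁, a₂, a₃, a₄, a₆] = MvPolynomial (Fin 5) ℤ` (variables in the order `a₁, a₂, a₃, a₄, a₆`).
[Silverman AEC IV.2.2 ("`F` … a formal group law over `ℤ[a₁, …, a₆]`")] [cite: SilvermanAEC2009, IV.1.1] -/
def universalInt : WeierstrassCurve (MvPolynomial (Fin 5) ℤ) :=
  ⟨MvPolynomial.X 0, MvPolynomial.X 1, MvPolynomial.X 2, MvPolynomial.X 3, MvPolynomial.X 4⟩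

variable {R : Type*} [CommRing R] (W : WeierstrassCurve R)

/-- The evaluation `ℤ[aᵢ] → R` at the coefficients of `W`. [folklore] -/
def universalEval : MvPolynomial (Fin 5) ℤ →+* R :=
  MvPolynomial.eval₂Hom (Int.castRingHom R) ![W.a₁, W.a₂, W.a₃, W.a₄, W.a₆]

/-- Every Weierstrass equation is a specialisation of the universal one. [folklore] -/
theorem universalInt_map : universalInt.map W.universalEval = W := by
  ext <;> simp [universalInt, universalEval, WeierstrassCurve.map]

/-- `ℤ[aᵢ] ↪ ℚ[aᵢ]`. [folklore] -/
theorem mvPolynomial_map_int_rat_injective :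
    Function.Injective (MvPolynomial.map (σ := Fin 5) (Int.castRingHom ℚ)) :=
  MvPolynomial.map_injective _ Int.cast_injective

/-- Pushing a two-entry substitution into `F` through a ring map. [folklore] -/
theorem map_subst_pair_formalGroupLaw {S : Type*} [CommRing S] (φ : R →+* S) {σ : Type*}
    {g h : MvPowerSeries σ R} (hg : MvPowerSeries.constantCoeff g = 0)
    (hh : MvPowerSeries.constantCoeff h = 0) :
    MvPowerSeries.map φ (MvPowerSeries.subst ![g, h] W.formalGroupLaw) =
      MvPowerSeries.subst ![MvPowerSeries.map φ g, MvPowerSeries.map φ h] (W.map φ).formalGroupLaw := by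
  rw [MvPowerSeries.map_subst (hasSubst_pair hg hh), map_formalGroupLaw]
  congr 1
  funext k
  fin_cases k <;> rfl

end Universal

/-! ### The axioms over every commutative ring -/

section AnyRing

variable {R : Type*} [CommRing R] (W : WeierstrassCurve R)

/-- **Commutativity of the formal group law of every Weierstrass curve over every commutative
ring**: `F(z₂, z₁) = F(z₁, z₂)` in `R⟦z₁, z₂⟧`. [Silverman AEC IV.2.1 (c), IV.2.2]
[cite: SilvermanAEC2009, IV.1.1] -/
theorem formalGroupLaw_comm' :
    MvPowerSeries.subst ![(MvPowerSeries.X 1 : MvPowerSeries (Fin 2) R), MvPowerSeries.X 0]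
        W.formalGroupLaw = W.formalGroupLaw := by
  -- over `ℚ[aᵢ]`
  have hQ := (universalInt.map (MvPolynomial.map (Int.castRingHom ℚ))).formalGroupLaw_comm_rat
  -- over `ℤ[aᵢ]`
  have hZ : MvPowerSeries.subst ![(MvPowerSeries.X 1 : MvPowerSeries (Fin 2) (MvPolynomial (Fin 5) ℤ)),
      MvPowerSeries.X 0] universalInt.formalGroupLaw = universalInt.formalGroupLaw := by
    apply mvPowerSeries_map_injective mvPolynomial_map_int_rat_injective
    rw [map_subst_pair_formalGroupLaw _ _ (MvPowerSeries.constantCoeff_X 1)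
      (MvPowerSeries.constantCoeff_X 0), MvPowerSeries.map_X, MvPowerSeries.map_X, hQ,
      map_formalGroupLaw]
  -- over `R`
  have hR := congrArg (MvPowerSeries.map W.universalEval) hZ
  rwa [map_subst_pair_formalGroupLaw _ _ (MvPowerSeries.constantCoeff_X 1)
    (MvPowerSeries.constantCoeff_X 0), MvPowerSeries.map_X, MvPowerSeries.map_X,
    map_formalGroupLaw, universalInt_map] at hR

/-- **`F(z, 0) = z` for every Weierstrass curve over every commutative ring.**
[Silverman AEC IV.2.1 (e), IV.2.2] [cite: SilvermanAEC2009, IV.1.1] -/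
theorem formalGroupLaw_subst_X_zero' :
    MvPowerSeries.subst ![(PowerSeries.X : R⟦X⟧), 0] W.formalGroupLaw = PowerSeries.X := by
  have hQ := (universalInt.map (MvPolynomial.map (Int.castRingHom ℚ))).formalGroupLaw_subst_X_zero_rat
  have hZ : MvPowerSeries.subst ![(PowerSeries.X : (MvPolynomial (Fin 5) ℤ)⟦X⟧), 0]
      universalInt.formalGroupLaw = PowerSeries.X := by
    apply mvPowerSeries_map_injective mvPolynomial_map_int_rat_injective
    have h := map_subst_pair_formalGroupLaw universalInt (MvPolynomial.map (Int.castRingHom ℚ))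
      (σ := Unit) (g := (PowerSeries.X : (MvPolynomial (Fin 5) ℤ)⟦X⟧)) (h := 0)
      PowerSeries.constantCoeff_X (map_zero _)
    rw [h]
    change MvPowerSeries.subst ![PowerSeries.map _ PowerSeries.X, PowerSeries.map _ 0] _ =
      PowerSeries.map _ PowerSeries.X
    rw [PowerSeries.map_X, map_zero, hQ]
  have hR := congrArg (MvPowerSeries.map W.universalEval) hZ
  rw [map_subst_pair_formalGroupLaw _ _ PowerSeries.constantCoeff_X (map_zero _),
    universalInt_map] at hR
  change MvPowerSeries.subst ![PowerSeries.map _ PowerSeries.X, PowerSeries.map _ 0] _ =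
    PowerSeries.map _ PowerSeries.X at hR
  rwa [PowerSeries.map_X, map_zero] at hR

/-- **`F(z, i(z)) = 0` for every Weierstrass curve over every commutative ring** (`i = formalNeg`
the formal inverse). [Silverman AEC IV.2.1 (d), IV.2.2] [cite: SilvermanAEC2009, IV.1.1] -/
theorem formalGroupLaw_subst_X_formalNeg' :
    MvPowerSeries.subst ![(PowerSeries.X : R⟦X⟧), W.formalNeg] W.formalGroupLaw = 0 := by
  have hQ := (universalInt.map (MvPolynomial.map (Int.castRingHom ℚ))).formalGroupLaw_subst_X_formalNeg_rat
  have hZ : MvPowerSeries.subst ![(PowerSeries.X : (MvPolynomial (Fin 5) ℤ)⟦X⟧), universalInt.formalNeg]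
      universalInt.formalGroupLaw = 0 := by
    apply mvPowerSeries_map_injective mvPolynomial_map_int_rat_injective
    have h := map_subst_pair_formalGroupLaw universalInt (MvPolynomial.map (Int.castRingHom ℚ))
      (σ := Unit) (g := (PowerSeries.X : (MvPolynomial (Fin 5) ℤ)⟦X⟧)) (h := universalInt.formalNeg)
      PowerSeries.constantCoeff_X universalInt.constantCoeff_formalNeg
    rw [h, map_zero]
    change MvPowerSeries.subst ![PowerSeries.map _ PowerSeries.X, PowerSeries.map _ _] _ = 0
    rw [PowerSeries.map_X, map_formalNeg, hQ]
  have hR := congrArg (MvPowerSeries.map W.universalEval) hZ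
  rw [map_subst_pair_formalGroupLaw _ _ PowerSeries.constantCoeff_X universalInt.constantCoeff_formalNeg,
    map_zero] at hR
  change MvPowerSeries.subst ![PowerSeries.map _ PowerSeries.X, PowerSeries.map _ _] _ = 0 at hR
  rwa [PowerSeries.map_X, map_formalNeg, universalInt_map] at hR

/-- `F(zᵢ, zⱼ)` read in three variables has no constant term (any ring). [folklore] -/
theorem constantCoeff_subst_X_pair_formalGroupLaw (i j : Fin 3) :
    MvPowerSeries.constantCoeff (MvPowerSeries.subst
      ![(MvPowerSeries.X i : MvPowerSeries (Fin 3) R), MvPowerSeries.X j] W.formalGroupLaw) = 0 :=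
  MvPowerSeries.constantCoeff_subst_eq_zero (hasSubst_X_pair i j)
    (fun k => by fin_cases k <;> exact MvPowerSeries.constantCoeff_X _) W.constantCoeff_formalGroupLaw

/-- `F(F(z₁,z₂),z₃)` commutes with base change. [folklore] -/
theorem map_formalGroupLaw_assoc_left {S : Type*} [CommRing S] (φ : R →+* S) :
    MvPowerSeries.map φ (MvPowerSeries.subst ![MvPowerSeries.subst
        ![(MvPowerSeries.X 0 : MvPowerSeries (Fin 3) R), MvPowerSeries.X 1] W.formalGroupLaw,
        MvPowerSeries.X 2] W.formalGroupLaw) =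
      MvPowerSeries.subst ![MvPowerSeries.subst ![(MvPowerSeries.X 0 : MvPowerSeries (Fin 3) S),
        MvPowerSeries.X 1] (W.map φ).formalGroupLaw, MvPowerSeries.X 2] (W.map φ).formalGroupLaw := by
  rw [map_subst_pair_formalGroupLaw W φ (W.constantCoeff_subst_X_pair_formalGroupLaw 0 1)
    (MvPowerSeries.constantCoeff_X 2), map_subst_pair_formalGroupLaw W φ
    (MvPowerSeries.constantCoeff_X 0) (MvPowerSeries.constantCoeff_X 1),
    MvPowerSeries.map_X, MvPowerSeries.map_X, MvPowerSeries.map_X]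

/-- `F(z₁,F(z₂,z₃))` commutes with base change. [folklore] -/
theorem map_formalGroupLaw_assoc_right {S : Type*} [CommRing S] (φ : R →+* S) :
    MvPowerSeries.map φ (MvPowerSeries.subst ![(MvPowerSeries.X 0 : MvPowerSeries (Fin 3) R),
        MvPowerSeries.subst ![(MvPowerSeries.X 1 : MvPowerSeries (Fin 3) R), MvPowerSeries.X 2]
          W.formalGroupLaw] W.formalGroupLaw) =
      MvPowerSeries.subst ![(MvPowerSeries.X 0 : MvPowerSeries (Fin 3) S),
        MvPowerSeries.subst ![(MvPowerSeries.X 1 : MvPowerSeries (Fin 3) S), MvPowerSeries.X 2]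
          (W.map φ).formalGroupLaw] (W.map φ).formalGroupLaw := by
  rw [map_subst_pair_formalGroupLaw W φ (MvPowerSeries.constantCoeff_X 0)
    (W.constantCoeff_subst_X_pair_formalGroupLaw 1 2), map_subst_pair_formalGroupLaw W φ
    (MvPowerSeries.constantCoeff_X 1) (MvPowerSeries.constantCoeff_X 2),
    MvPowerSeries.map_X, MvPowerSeries.map_X, MvPowerSeries.map_X]

/-- **Associativity of the formal group law of every Weierstrass curve over every commutative
ring**: `F(F(z₁,z₂),z₃) = F(z₁,F(z₂,z₃))` in `R⟦z₁, z₂, z₃⟧`. [Silverman AEC IV.2.1 (b), IV.2.2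
("a formal group law over `ℤ[a₁, …, a₆]`")] [cite: SilvermanAEC2009, IV.1.1] -/
theorem formalGroupLaw_assoc' :
    MvPowerSeries.subst ![MvPowerSeries.subst ![(MvPowerSeries.X 0 : MvPowerSeries (Fin 3) R),
        MvPowerSeries.X 1] W.formalGroupLaw, MvPowerSeries.X 2] W.formalGroupLaw =
      MvPowerSeries.subst ![(MvPowerSeries.X 0 : MvPowerSeries (Fin 3) R),
        MvPowerSeries.subst ![(MvPowerSeries.X 1 : MvPowerSeries (Fin 3) R), MvPowerSeries.X 2]
          W.formalGroupLaw] W.formalGroupLaw := by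
  have hQ := (universalInt.map (MvPolynomial.map (Int.castRingHom ℚ))).formalGroupLaw_assoc_rat
  have hZ : MvPowerSeries.subst ![MvPowerSeries.subst ![(MvPowerSeries.X 0 :
      MvPowerSeries (Fin 3) (MvPolynomial (Fin 5) ℤ)), MvPowerSeries.X 1] universalInt.formalGroupLaw,
        MvPowerSeries.X 2] universalInt.formalGroupLaw =
      MvPowerSeries.subst ![(MvPowerSeries.X 0 : MvPowerSeries (Fin 3) (MvPolynomial (Fin 5) ℤ)),
        MvPowerSeries.subst ![(MvPowerSeries.X 1 : MvPowerSeries (Fin 3) (MvPolynomial (Fin 5) ℤ)),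
          MvPowerSeries.X 2] universalInt.formalGroupLaw] universalInt.formalGroupLaw := by
    apply mvPowerSeries_map_injective mvPolynomial_map_int_rat_injective
    rw [map_formalGroupLaw_assoc_left, map_formalGroupLaw_assoc_right, hQ]
  have hR := congrArg (MvPowerSeries.map W.universalEval) hZ
  rwa [map_formalGroupLaw_assoc_left, map_formalGroupLaw_assoc_right, universalInt_map] at hR

end AnyRing

end WeierstrassCurve
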